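import Summits.AtomisticToContinuum.HydrodynamicLimit.Theorems.RelayRaceLocalityNearConstantShortTimeHLTiltL2Defs
import Summits.AtomisticToContinuum.HydrodynamicLimit.Theorems.RelayRaceLocalityNearConstantShortTimeHLGeneralFamilyConcentrationContraction
import HarnessLib

/-!
# Crux `NearConstantShortTimeHL` (stmt-AtomisticToContinuum-12502), line `small-tilt-domination`, v16b — registered helper
# `tl_onePointUniform_of2 : CoefRateNonneg → RatioRate → OnePointUniform` (the CENTRING of the L² route)

Support file (`--supports stmt-AtomisticToContinuum-12502`): the one-point expectation `M^G(n)/Ξ(n)` converges to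
`I(G) = Σ_j γ_j (∫Gβ^{j+1}) R^{j+1}` along general families, UNIFORMLY over measurable `|G| ≤ 1` and over profiles in the statics
regime with bounded, uniformly Lipschitz density. `tlp_abs_onePt_sub_Ilim_le` is the deterministic estimate at a fixed `(ε, n)`
(decorated expansion `M^G(m+1)/Ξ(m+1) = q(m) Σ_j C(m,j) W^G(j+1) Ξ(m-j)/Ξ(m)` against `I(G) = R Σ_j γ_j(∫Gβ^{j+1}) Rʲ`, heads + geometric
tails, as the tree's `gf_abs_inv_q_sub_inv_le`); the main theorem chooses `J`, the number `K` of contraction steps of `RatioRate`,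
the tolerance `τ`, and uses `C(n_N-1-s, j) ε_N^{3j} → σ^{3j}/j!`. Ref: Pulvirenti–Tsagkarogiannis, CMP 316 (2012) Thm 2.1, §5.
-/

noncomputable section

namespace Summit.AtomisticToContinuum.HydrodynamicLimit.Theorems.NearConstantShortTimeHL

open scoped BigOperators ENNReal
open MeasureTheory Set Filter Topology Finset
open Literature.MathematicalPhysics.KineticTheory Literature.MathematicalPhysics.StatisticalMechanics
open Literature.Probability.LatticeModels

/-! ## §1 The deterministic estimate -/

/-- **The deterministic one-point estimate.** At a fixed `(ε, n)` with `n p_ε ≤ λ`, `ovDensity P σ ≤ λ`, `2eλ ≤ 1/14`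
(`θ = 2eλ`, `κ₊ = eθ/(1-θ)²`), for `J ≤ m < n` and a measurable `|G| ≤ 1`: if `|Ξ(m)/Ξ(m+1) - R| ≤ η`,
`|Ξ(m-1-i)/Ξ(m-i) - R| ≤ η` for `i < J` and `|C(m,j) W^G(j+1) - γ_j ∫Gβ^{j+1}| ≤ τ` for `j ≤ J` (`R = ratioLimit P σ`), then
`|M^G(m+1)/Ξ(m+1) - I(G)| ≤ 2 ((J+1) 2ᴶ τ + κ₊ η + 2 e θ^{J+1}/(1-θ)) + (e/(1-θ)) η`. [cite: PulvirentiTsagkarogiannis2012, §5] -/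
theorem tlp_abs_onePt_sub_Ilim_le {P : DensityProfile} {σ lam e : ℝ} {n : ℕ} [NeZero n] (hP : SmallDensity P σ)
    (hlamσ : ovDensity P σ ≤ lam) (hlam : 2 * Real.exp 1 * lam ≤ 1 / 14) (he : 0 ≤ e) (he2 : e < 1 / 2)
    (hnp : (n : ℝ) * pOv P e ≤ lam) {m J : ℕ} (hJ : J ≤ m) (hm : m < n) {G : T3 → ℝ} (hG : Measurable G)
    (hG1 : ∀ y, |G y| ≤ 1) {η τ : ℝ} (hη : 0 ≤ η) (hτ : 0 ≤ τ)
    (hq0 : |Xi P e n m / Xi P e n (m + 1) - ratioLimit P σ| ≤ η)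
    (hq : ∀ i < J, |Xi P e n (m - 1 - i) / Xi P e n (m - 1 - i + 1) - ratioLimit P σ| ≤ η)
    (hc : ∀ j ≤ J, |(m.choose j : ℝ) * Wd P e n G (j + 1) - coefLim P σ G j| ≤ τ) :
    |Md P e n G (m + 1) / Xi P e n (m + 1) - Ilim P σ G| ≤
      2 * ((J + 1) * 2 ^ J * τ + (Real.exp 1 * (2 * Real.exp 1 * lam) / (1 - 2 * Real.exp 1 * lam) ^ 2) * η +
          2 * (Real.exp 1 * (2 * Real.exp 1 * lam) ^ (J + 1) / (1 - 2 * Real.exp 1 * lam))) +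
        (Real.exp 1 / (1 - 2 * Real.exp 1 * lam)) * η := by
  have he0 : 0 < Real.exp 1 := Real.exp_pos 1; have hlam0 : 0 ≤ lam := gf_lam_nonneg hnp he
  obtain ⟨hθ1, hlam2, -, -⟩ := gf_slack_numerics hlam0 hlam; have hlam1 : lam < 1 := by linarith
  set θ := 2 * Real.exp 1 * lam with hθdef
  have hθ0 : 0 ≤ θ := by positivity
  set R := ratioLimit P σ with hR_def
  have hR0 : 0 < R := hP.ratioLimit_pos; have hR2 : R ≤ 2 := hP.ratioLimit_mem.2
  have hRabs := hP.abs_ratioLimit_le; have hov0 : 0 ≤ ovDensity P σ := hP.ovDensity_nonneg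
  have hgeomθ : geomRatio P σ ≤ θ := by
    rw [geomRatio, hθdef]; exact mul_le_mul_of_nonneg_left hlamσ (by positivity)
  -- the two decompositions
  set a : ℕ → ℝ := fun j => ((m.choose j : ℝ) * Wd P e n G (j + 1)) * (Xi P e n (m - j) / Xi P e n m) with ha
  set b : ℕ → ℝ := fun j => coefLim P σ G j * R ^ j with hb
  have hbnd_b : ∀ j, |b j| ≤ Real.exp 1 * geomRatio P σ ^ j := by
    intro j
    have h := abs_coefLim_le (P := P) hP.σ_pos hP.σ_lt_half hG hG1 j; rw [one_mul] at h
    simp only [hb, abs_mul, abs_pow]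
    calc |coefLim P σ G j| * |R| ^ j ≤ (Real.exp 1 * (Real.exp 1 * ovDensity P σ) ^ j) * 2 ^ j := by gcongr
      _ = Real.exp 1 * geomRatio P σ ^ j := by rw [geomRatio, mul_assoc, ← mul_pow]; ring_nf
  have hsum_b : Summable b :=
    Summable.of_norm_bounded ((summable_geometric_of_lt_one hP.geomRatio_nonneg hP.geomRatio_lt_one).mul_left _)
      fun j => (Real.norm_eq_abs _).trans_le (hbnd_b j)
  set q := Xi P e n m / Xi P e n (m + 1) with hqdef
  have hXm : 0 < Xi P e n m := gf_Xi_pos he he2 hnp hlam1 (by omega)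
  have hXm1 : 0 < Xi P e n (m + 1) := gf_Xi_pos he he2 hnp hlam1 (by omega)
  -- `M^G(m+1)/Ξ(m+1) = q · Σ_j a_j`
  have hA_eq : Md P e n G (m + 1) / Xi P e n (m + 1) =
      q * (∑ j ∈ range (J + 1), a j + ∑ j ∈ Ico (J + 1) (m + 1), a j) := by
    rw [Finset.sum_range_add_sum_Ico _ (by omega : J + 1 ≤ m + 1),
      Md_eq_sum hG hG1 (m := m + 1) (by omega) (by omega), Finset.sum_div, Finset.mul_sum]
    refine Finset.sum_congr rfl fun j hj => ?_
    have hjm : j ≤ m := Nat.lt_succ_iff.mp (mem_range.mp hj)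
    simp only [ha, hqdef, show m + 1 - 1 = m from rfl]
    field_simp
  -- `I(G) = R · Σ' b_j`
  have hI_eq : Ilim P σ G = R * (∑ j ∈ range (J + 1), b j + ∑' j, b (j + (J + 1))) := by
    rw [hsum_b.sum_add_tsum_nat_add (J + 1), Ilim, ← tsum_mul_left]
    refine tsum_congr fun j => ?_
    simp only [hb, hR_def, pow_succ]
    ring
  -- bounds on the limit coefficients
  have hcl : ∀ j, |coefLim P σ G j| ≤ Real.exp 1 * (Real.exp 1 * lam) ^ j := by
    intro j
    have h := abs_coefLim_le (P := P) hP.σ_pos hP.σ_lt_half hG hG1 j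
    rw [one_mul] at h
    refine h.trans (mul_le_mul_of_nonneg_left (pow_le_pow_left₀ (by positivity) ?_ j) he0.le)
    exact mul_le_mul_of_nonneg_left hlamσ he0.le
  -- head terms
  have hhead : ∀ j ∈ range (J + 1), |a j - b j| ≤ 2 ^ J * τ + Real.exp 1 * ((j : ℝ) * θ ^ j) * η := by
    intro j hj
    have hjJ : j ≤ J := Nat.lt_succ_iff.mp (mem_range.mp hj)
    set r := Xi P e n (m - j) / Xi P e n m with hr
    have hrr0 : 0 ≤ r := zero_le_one.trans (gf_one_le_r he he2 hnp hlam1 (by omega) (by omega))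
    have hrr2 : r ≤ 2 ^ J :=
      (gf_r_le_two_pow he he2 hnp hlam1 hlam2 (by omega) (by omega)).trans (pow_le_pow_right₀ (by norm_num) hjJ)
    have hrrR : |r - R ^ j| ≤ j * 2 ^ j * η :=
      gf_abs_r_sub_pow_le he he2 hnp hlam1 hlam2 hR0 hR2 (by omega : m ≤ n) (by omega) fun i hi => hq i (by omega)
    have hcj := hc j hjJ
    have hsplit : a j - b j = ((m.choose j : ℝ) * Wd P e n G (j + 1) - coefLim P σ G j) * r +
        coefLim P σ G j * (r - R ^ j) := by
      simp only [ha, hb]; ring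
    rw [hsplit]
    calc |((m.choose j : ℝ) * Wd P e n G (j + 1) - coefLim P σ G j) * r + coefLim P σ G j * (r - R ^ j)|
        ≤ |(m.choose j : ℝ) * Wd P e n G (j + 1) - coefLim P σ G j| * r + |coefLim P σ G j| * |r - R ^ j| := by
          refine (abs_add_le _ _).trans (le_of_eq ?_)
          rw [abs_mul, abs_mul, abs_of_nonneg hrr0]
      _ ≤ τ * 2 ^ J + (Real.exp 1 * (Real.exp 1 * lam) ^ j) * (j * 2 ^ j * η) :=
          add_le_add (mul_le_mul hcj hrr2 hrr0 hτ) (mul_le_mul (hcl j) hrrR (abs_nonneg _) (by positivity))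
      _ = 2 ^ J * τ + Real.exp 1 * ((j : ℝ) * θ ^ j) * η := by
          rw [hθdef, show (2 * Real.exp 1 * lam) ^ j = 2 ^ j * (Real.exp 1 * lam) ^ j by
            rw [← mul_pow]; ring_nf]
          ring
  have hκ : Real.exp 1 * ∑ j ∈ range (J + 1), (j : ℝ) * θ ^ j ≤ Real.exp 1 * θ / (1 - θ) ^ 2 := by
    have h := hasSum_coe_mul_geometric_of_norm_lt_one (𝕜 := ℝ) (r := θ)
      (by rw [Real.norm_eq_abs, abs_of_nonneg hθ0]; exact hθ1)
    rw [mul_div_assoc]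
    exact mul_le_mul_of_nonneg_left (sum_le_hasSum _ (fun j _ => by positivity) h) he0.le
  have hhead_sum : |∑ j ∈ range (J + 1), (a j - b j)| ≤ (J + 1) * 2 ^ J * τ + (Real.exp 1 * θ / (1 - θ) ^ 2) * η := by
    refine (abs_sum_le_sum_abs _ _).trans ((sum_le_sum hhead).trans ?_)
    have hs : ∑ j ∈ range (J + 1), (2 ^ J * τ + Real.exp 1 * ((j : ℝ) * θ ^ j) * η) =
        (J + 1) * 2 ^ J * τ + (Real.exp 1 * ∑ j ∈ range (J + 1), (j : ℝ) * θ ^ j) * η := by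
      rw [sum_add_distrib, sum_const, card_range, nsmul_eq_mul, Finset.mul_sum, Finset.sum_mul]; push_cast; ring
    rw [hs]
    nlinarith
  -- geometric tails and the bound on `Σ a_j`
  have hgeo_tail : ∀ K : ℕ, Real.exp 1 * ∑ j ∈ Ico (J + 1) K, θ ^ j ≤ Real.exp 1 * θ ^ (J + 1) / (1 - θ) := by
    intro K
    rw [mul_div_assoc]
    refine mul_le_mul_of_nonneg_left ?_ he0.le
    rw [Finset.sum_Ico_eq_sum_range]
    have h := (hasSum_geometric_of_lt_one hθ0 hθ1).mul_left (θ ^ (J + 1))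
    rw [← div_eq_mul_inv] at h
    refine le_trans (le_of_eq ?_) (sum_le_hasSum (range (K - (J + 1))) (fun j _ => by positivity) h)
    exact sum_congr rfl fun j _ => by rw [pow_add]
  have hterm_a : ∀ j ≤ m, |a j| ≤ Real.exp 1 * θ ^ j := by
    intro j hjm
    have hrr0 : 0 ≤ Xi P e n (m - j) / Xi P e n m :=
      zero_le_one.trans (gf_one_le_r he he2 hnp hlam1 (by omega) hjm)
    have hrr2 : Xi P e n (m - j) / Xi P e n m ≤ 2 ^ j := gf_r_le_two_pow he he2 hnp hlam1 hlam2 (by omega) hjm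
    have hco := gf_abs_coef_le (P := P) he he2 hnp hG hG1 (m := m) (j := j) (by omega) (by omega)
    rw [one_mul] at hco
    simp only [ha, abs_mul, abs_of_nonneg hrr0]
    rw [← abs_mul]
    calc |(m.choose j : ℝ) * Wd P e n G (j + 1)| * (Xi P e n (m - j) / Xi P e n m)
        ≤ (Real.exp 1 * (Real.exp 1 * lam) ^ j) * 2 ^ j := mul_le_mul hco hrr2 hrr0 (by positivity)
      _ = Real.exp 1 * θ ^ j := by rw [hθdef, mul_assoc, ← mul_pow]; ring_nf
  have htail_a : |∑ j ∈ Ico (J + 1) (m + 1), a j| ≤ Real.exp 1 * θ ^ (J + 1) / (1 - θ) := by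
    refine (abs_sum_le_sum_abs _ _).trans ?_
    refine (sum_le_sum fun j hj => hterm_a j (Nat.lt_succ_iff.mp (mem_Ico.mp hj).2)).trans ?_
    rw [← mul_sum]
    exact hgeo_tail (m + 1)
  have hSa : |∑ j ∈ range (J + 1), a j + ∑ j ∈ Ico (J + 1) (m + 1), a j| ≤ Real.exp 1 / (1 - θ) := by
    rw [Finset.sum_range_add_sum_Ico _ (by omega : J + 1 ≤ m + 1)]
    refine (abs_sum_le_sum_abs _ _).trans ?_
    refine (sum_le_sum fun j hj => hterm_a j (Nat.lt_succ_iff.mp (mem_range.mp hj))).trans ?_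
    rw [← mul_sum, div_eq_mul_one_div]
    refine mul_le_mul_of_nonneg_left ?_ he0.le
    have h := hasSum_geometric_of_lt_one hθ0 hθ1
    rw [← one_div] at h
    exact sum_le_hasSum _ (fun j _ => by positivity) h
  have htail_b : |∑' j, b (j + (J + 1))| ≤ Real.exp 1 * θ ^ (J + 1) / (1 - θ) := by
    have hg0 := hP.geomRatio_nonneg; have hg1 := hP.geomRatio_lt_one
    have hgeo : HasSum (fun j : ℕ => Real.exp 1 * geomRatio P σ ^ (j + (J + 1)))
        (Real.exp 1 * geomRatio P σ ^ (J + 1) / (1 - geomRatio P σ)) := by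
      have h := (hasSum_geometric_of_lt_one hg0 hg1).mul_left (Real.exp 1 * geomRatio P σ ^ (J + 1))
      rw [div_eq_mul_inv]
      refine h.congr_fun fun j => ?_
      rw [pow_add]; ring
    refine ((Real.norm_eq_abs _).symm.trans_le (tsum_of_norm_bounded hgeo fun j => ?_)).trans ?_
    · rw [Real.norm_eq_abs]; exact hbnd_b _
    · exact div_le_div₀ (by positivity) (mul_le_mul_of_nonneg_left (pow_le_pow_left₀ hg0 hgeomθ _) he0.le)
        (by linarith) (by linarith)
  -- `|Σ a - Σ b|`
  have hSab : |(∑ j ∈ range (J + 1), a j + ∑ j ∈ Ico (J + 1) (m + 1), a j) -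
      (∑ j ∈ range (J + 1), b j + ∑' j, b (j + (J + 1)))| ≤
      (J + 1) * 2 ^ J * τ + (Real.exp 1 * θ / (1 - θ) ^ 2) * η + 2 * (Real.exp 1 * θ ^ (J + 1) / (1 - θ)) := by
    have hdiff : (∑ j ∈ range (J + 1), a j + ∑ j ∈ Ico (J + 1) (m + 1), a j) -
        (∑ j ∈ range (J + 1), b j + ∑' j, b (j + (J + 1))) =
        ∑ j ∈ range (J + 1), (a j - b j) + ∑ j ∈ Ico (J + 1) (m + 1), a j - ∑' j, b (j + (J + 1)) := by
      rw [sum_sub_distrib]; ring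
    rw [hdiff]
    have h3 : ∀ x y z : ℝ, |x + y - z| ≤ |x| + |y| + |z| := fun x y z =>
      (abs_sub _ _).trans (by gcongr; exact abs_add_le x y)
    refine (h3 _ _ _).trans ?_
    linarith
  -- assemble: `A - I = (q - R) Σa + R (Σa - Σb)`
  rw [hA_eq, hI_eq]
  set Sa := ∑ j ∈ range (J + 1), a j + ∑ j ∈ Ico (J + 1) (m + 1), a j with hSa_def
  set Sb := ∑ j ∈ range (J + 1), b j + ∑' j, b (j + (J + 1)) with hSb_def
  have hsplit : q * Sa - R * Sb = (q - R) * Sa + R * (Sa - Sb) := by ring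
  rw [hsplit]
  calc |(q - R) * Sa + R * (Sa - Sb)| ≤ |q - R| * |Sa| + R * |Sa - Sb| := by
        refine (abs_add_le _ _).trans (le_of_eq ?_)
        rw [abs_mul, abs_mul, abs_of_pos hR0]
    _ ≤ η * (Real.exp 1 / (1 - θ)) +
        2 * ((J + 1) * 2 ^ J * τ + (Real.exp 1 * θ / (1 - θ) ^ 2) * η + 2 * (Real.exp 1 * θ ^ (J + 1) / (1 - θ))) :=
        add_le_add (mul_le_mul hq0 hSa (abs_nonneg _) hη) (mul_le_mul hR2 hSab (abs_nonneg _) zero_le_two)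
    _ = _ := by rw [hθdef]; ring

/-! ## §2 The registered helper -/

/-- A geometric choice: for `0 ≤ x < 1` and `t > 0` there is `J` with `A x^{J+1} ≤ t` (`A ≥ 0`). [folklore] -/
theorem tlp_exists_pow_le {x A t : ℝ} (hx0 : 0 ≤ x) (hx1 : x < 1) (hA : 0 ≤ A) (ht : 0 < t) :
    ∃ J : ℕ, A * x ^ (J + 1) ≤ t := by
  obtain ⟨J, hJ⟩ := exists_pow_lt_of_lt_one (show 0 < t / (A + 1) by positivity) hx1
  refine ⟨J, ?_⟩
  have h1 : x ^ (J + 1) ≤ x ^ J := pow_le_pow_of_le_one hx0 hx1.le (Nat.le_succ J)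
  have h2 : A * x ^ (J + 1) ≤ (A + 1) * x ^ J := mul_le_mul (by linarith) h1 (pow_nonneg hx0 _) (by linarith)
  refine h2.trans ?_
  rw [lt_div_iff₀ (by linarith)] at hJ
  linarith

set_option maxHeartbeats 800000 in
/-- **`tl_onePointUniform_of2 : CoefRateNonneg → RatioRate → OnePointUniform`** (registered helper of crux
stmt-AtomisticToContinuum-12502, skeleton v16b of line `small-tilt-domination`; the signed form `CoefRateNonneg` replaces the
misstated `CoefRate`): the uniform one-point limit along general families from the cluster limit with a rate and the insertion
ratios with a rate. [cite: PulvirentiTsagkarogiannis2012, Thm 2.1] -/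
theorem tl_onePointUniform_of2 : CoefRateNonneg → RatioRate → OnePointUniform := by
  intro hC hR
  obtain ⟨Θ, hΘ0, hCoef⟩ := hC
  intro σ lam Mstar L hσ hσ2 hlam0 hlam14 ε n _ hε hε0 hnε δ hδ
  -- constants
  have he0 : 0 < Real.exp 1 := Real.exp_pos 1
  obtain ⟨hθ1, hlam2, hc1, hκ0⟩ := gf_slack_numerics hlam0.le hlam14
  set θ := 2 * Real.exp 1 * lam with hθ
  have hθ0 : 0 ≤ θ := by positivity
  set κp := Real.exp 1 * θ / (1 - θ) ^ 2 with hκp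
  set c := 4 * κp with hcdef
  have hc0 : 0 ≤ c := by positivity
  have h1θ : 0 < 1 - θ := by linarith
  have h1c : 0 < 1 - c := by linarith
  set Bf := Real.exp 1 / (1 - θ) + 2 * κp with hBf
  have hBf0 : 0 ≤ Bf := by rw [hBf]; exact add_nonneg (div_nonneg he0.le h1θ.le) (by positivity)
  have hBf1 : 0 < Bf + 1 := by linarith
  have h32 : 0 < 32 * (Bf + 1) := by positivity
  -- the truncation order `J`
  obtain ⟨J, hJ⟩ := tlp_exists_pow_le hθ0 hθ1 (div_nonneg he0.le h1θ.le)
    (show 0 < min (δ / 16) (δ * (1 - c) / (32 * (Bf + 1))) from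
      lt_min (by positivity) (div_pos (mul_pos hδ h1c) h32))
  set TJ := Real.exp 1 * θ ^ (J + 1) / (1 - θ) with hTJ
  have hTJ0 : 0 ≤ TJ := by rw [hTJ]; exact div_nonneg (by positivity) h1θ.le
  have hTJeq : Real.exp 1 / (1 - θ) * θ ^ (J + 1) = TJ := by rw [hTJ]; ring
  rw [hTJeq] at hJ
  have hTJ1 : TJ ≤ δ / 16 := hJ.trans (min_le_left _ _)
  have hTJ2 : TJ ≤ δ * (1 - c) / (32 * (Bf + 1)) := hJ.trans (min_le_right _ _)
  -- the number of contraction steps `K`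
  obtain ⟨K', hK'⟩ := tlp_exists_pow_le hc0 hc1 (show (0 : ℝ) ≤ 2 by norm_num)
    (show 0 < δ / (16 * (Bf + 1)) from div_pos hδ (by positivity))
  set K := K' + 1 with hKdef
  have hK : 2 * c ^ K ≤ δ / (16 * (Bf + 1)) := hK'
  -- the coefficient tolerance `τ`
  set τ : ℝ := min (δ / (16 * ((J : ℝ) + 1) * 2 ^ J)) (δ * (1 - c) / (32 * (Bf + 1) * ((J : ℝ) + 1) * 2 ^ J)) with hτdef
  have hJ2 : 0 < ((J : ℝ) + 1) * 2 ^ J := by positivity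
  have hd1 : 0 < 16 * ((J : ℝ) + 1) * 2 ^ J := by positivity
  have hd2 : 0 < 32 * (Bf + 1) * ((J : ℝ) + 1) * 2 ^ J := by positivity
  have hτ0 : 0 < τ := lt_min (div_pos hδ hd1) (div_pos (mul_pos hδ h1c) hd2)
  have hτ1 : ((J : ℝ) + 1) * 2 ^ J * τ ≤ δ / 16 := by
    have h := min_le_left (δ / (16 * ((J : ℝ) + 1) * 2 ^ J)) (δ * (1 - c) / (32 * (Bf + 1) * ((J : ℝ) + 1) * 2 ^ J))
    rw [← hτdef, le_div_iff₀ hd1] at h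
    rw [le_div_iff₀ (by norm_num : (0 : ℝ) < 16)]
    nlinarith [h]
  have hτ2 : ((J : ℝ) + 1) * 2 ^ J * τ ≤ δ * (1 - c) / (32 * (Bf + 1)) := by
    have h := min_le_right (δ / (16 * ((J : ℝ) + 1) * 2 ^ J)) (δ * (1 - c) / (32 * (Bf + 1) * ((J : ℝ) + 1) * 2 ^ J))
    rw [← hτdef, le_div_iff₀ hd2] at h
    rw [le_div_iff₀ h32]
    nlinarith [h]
  -- the coefficient error terms along the family
  set f : ℕ → ℕ → ℕ → ℝ := fun s j N => Θ j *
      (|((n N - 1 - s).choose j : ℝ) * ε N ^ (3 * j) - (σ ^ 3) ^ j / (j.factorial : ℝ)| * (1 + Mstar) ^ j +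
        (σ ^ 3) ^ j * (1 + Mstar) ^ j * |L| * ε N) with hf
  have hnat : Tendsto n atTop atTop := gf_tendsto_atTop hσ hε hε0 hnε
  have hf0 : ∀ s j, Tendsto (f s j) atTop (nhds 0) := by
    intro s j
    have hm : Tendsto (fun N => n N - 1 - s) atTop atTop := by
      have h := (tendsto_sub_atTop_nat (1 + s)).comp hnat
      refine h.congr fun N => ?_
      simp only [Function.comp_apply]; omega
    have hr : Tendsto (fun N => ((n N - 1 - s : ℕ) : ℝ) * ε N ^ 3) atTop (nhds (σ ^ 3)) := by
      have h := gf_tendsto_sub_mul hσ hε hε0 hnε (1 + s)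
      refine h.congr fun N => ?_
      rw [show n N - (1 + s) = n N - 1 - s by omega]
    have h1 := gf_tendsto_choose_mul_pow j hm hr
    have h2 : Tendsto (fun N => ((n N - 1 - s).choose j : ℝ) * ε N ^ (3 * j) - (σ ^ 3) ^ j / (j.factorial : ℝ)) atTop
        (nhds 0) := by
      have h3 := h1.sub_const ((σ ^ 3) ^ j / (j.factorial : ℝ))
      rw [sub_self] at h3
      refine h3.congr fun N => ?_
      rw [pow_mul]
    have h4 : Tendsto (fun N => (σ ^ 3) ^ j * (1 + Mstar) ^ j * |L| * ε N) atTop (nhds 0) := by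
      simpa using hε0.const_mul ((σ ^ 3) ^ j * (1 + Mstar) ^ j * |L|)
    have h5 := ((h2.abs.mul_const ((1 + Mstar) ^ j)).add h4).const_mul (Θ j)
    simp only [abs_zero, zero_mul, zero_add, mul_zero] at h5
    exact h5
  have hev5 : ∀ᶠ N in atTop, ∀ s ∈ range (J + K * J + 1), ∀ j ∈ range (J + 1), f s j N ≤ τ := by
    rw [eventually_all_finset]
    intro s _
    rw [eventually_all_finset]
    intro j _
    exact ((hf0 s j).eventually (gt_mem_nhds hτ0)).mono fun N h => h.le
  -- the other eventual conditions
  have hev1 : ∀ᶠ N in atTop, ε N < 1 / 2 := hε0.eventually (gt_mem_nhds (by norm_num))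
  have hev2 : ∀ᶠ N in atTop, (n N : ℝ) * ε N ^ 3 ≤ 2 * σ ^ 3 :=
    (hnε.eventually (Iic_mem_nhds (by nlinarith [pow_pos hσ 3]))).mono fun N hN => hN
  have hev3 : ∀ᶠ N in atTop, (J : ℝ) * ε N < 1 / 4 := by
    have h := hε0.const_mul (J : ℝ)
    rw [mul_zero] at h
    exact h.eventually (gt_mem_nhds (by norm_num))
  have hev4 : ∀ᶠ N in atTop, J + K * J + J + 3 ≤ n N := hnat.eventually_ge_atTop _
  filter_upwards [hev1, hev2, hev3, hev4, hev5] with N h1 h2 h3 h4 h5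
  intro P hP hov hM hLip G hG hG1
  -- smallness at `(ε N, n N)`
  have he : 0 ≤ ε N := (hε N).le
  have hσ3 : 0 < σ ^ 3 := pow_pos hσ 3
  have hlamσ : ovDensity P σ ≤ lam := hov.trans (by linarith)
  have hnp : (n N : ℝ) * pOv P (ε N) ≤ lam := by
    rw [pOv]
    have hov' : P.M * v₁ * σ ^ 3 ≤ lam / 2 := by rw [ovDensity] at hov; exact hov
    have hMv : 0 ≤ P.M * v₁ := (mul_pos P.M_pos v₁_pos).le
    calc (n N : ℝ) * (P.M * v₁ * ε N ^ 3) = P.M * v₁ * ((n N : ℝ) * ε N ^ 3) := by ring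
      _ ≤ P.M * v₁ * (2 * σ ^ 3) := mul_le_mul_of_nonneg_left h2 hMv
      _ = 2 * (P.M * v₁ * σ ^ 3) := by ring
      _ ≤ 2 * (lam / 2) := by linarith
      _ = lam := by ring
  have hpowM : ∀ j, (1 + P.M) ^ j ≤ (1 + Mstar) ^ j := fun j =>
    pow_le_pow_left₀ (by linarith [P.M_pos]) (by linarith) j
  -- the coefficient bounds at all levels `m' ∈ [m₀, n N)`, for any `|g| ≤ 1`
  have hcoef : ∀ g : T3 → ℝ, Measurable g → (∀ y, |g y| ≤ 1) → ∀ m' : ℕ, n N - 1 - J - K * J ≤ m' → m' < n N →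
      ∀ j ≤ J, |(m'.choose j : ℝ) * Wd P (ε N) (n N) g (j + 1) - coefLim P σ g j| ≤ τ := by
    intro g hg hg1 m' hm0 hm' j hj
    have hje : (j : ℝ) * ε N < 1 / 4 :=
      lt_of_le_of_lt (mul_le_mul_of_nonneg_right (Nat.cast_le.2 hj) he) h3
    have h := hCoef P L hLip σ (ε N) hσ.le (hε N) j hje (n N) (by omega) (n N - 1 - m') g hg 1 hg1
    rw [show n N - 1 - (n N - 1 - m') = m' by omega, one_mul] at h
    refine h.trans ?_
    have hf5 := h5 (n N - 1 - m') (by rw [Finset.mem_range]; omega) j (by rw [Finset.mem_range]; omega)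
    simp only [hf] at hf5
    rw [show n N - 1 - (n N - 1 - m') = m' by omega] at hf5
    refine le_trans (mul_le_mul_of_nonneg_left (add_le_add (mul_le_mul_of_nonneg_left (hpowM j) (abs_nonneg _)) ?_)
      (hΘ0 j)) hf5
    have hσj : 0 ≤ (σ ^ 3) ^ j := pow_nonneg hσ3.le j
    have hPM1 : 0 ≤ (1 + P.M) ^ j := pow_nonneg (by linarith [P.M_pos]) j
    calc (σ ^ 3) ^ j * (1 + P.M) ^ j * L * ε N ≤ (σ ^ 3) ^ j * (1 + P.M) ^ j * |L| * ε N :=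
          mul_le_mul_of_nonneg_right (mul_le_mul_of_nonneg_left (le_abs_self L) (mul_nonneg hσj hPM1)) he
      _ ≤ (σ ^ 3) ^ j * (1 + Mstar) ^ j * |L| * ε N :=
          mul_le_mul_of_nonneg_right (mul_le_mul_of_nonneg_right (mul_le_mul_of_nonneg_left (hpowM j) hσj)
            (abs_nonneg L)) he
  -- the ratio bounds after `K` contraction steps
  set ηR : ℝ := 2 * c ^ K + 4 * (((J : ℝ) + 1) * 2 ^ J * τ + 2 * TJ) / (1 - c) with hηR
  have hηR0 : 0 ≤ ηR := by rw [hηR]; exact add_nonneg (by positivity) (div_nonneg (by positivity) h1c.le)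
  have hrat : ∀ m' : ℕ, (n N - 1 - J - K * J) + K * J ≤ m' → m' < n N →
      |Xi P (ε N) (n N) m' / Xi P (ε N) (n N) (m' + 1) - ratioLimit P σ| ≤ ηR := by
    intro m' hm0 hm'
    have h := hR P σ lam (ε N) (n N) hP hlamσ hlam14 he h1 hnp J (n N - 1 - J - K * J) (by omega) τ hτ0.le
      (hcoef (fun _ => 1) measurable_const (fun _ => by simp)) K m' hm0 hm'
    simp only [hηR, hcdef, hκp, hTJ, hθ]
    exact h
  -- the deterministic estimate at level `m = n N - 1`
  have hdet := tlp_abs_onePt_sub_Ilim_le hP hlamσ hlam14 he h1 hnp (m := n N - 1) (J := J) (by omega) (by omega)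
    hG hG1 hηR0 hτ0.le (hrat (n N - 1) (by omega) (by omega))
    (fun i hi => hrat (n N - 1 - 1 - i) (by omega) (by omega))
    (hcoef G hG hG1 (n N - 1) (by omega) (by omega))
  rw [show n N - 1 + 1 = n N by omega] at hdet
  refine hdet.trans ?_
  -- the final numerics
  have hBfη : Bf * ηR ≤ δ / 2 := by
    have e1 : Bf * ηR = Bf * (2 * c ^ K) + Bf * (4 * (((J : ℝ) + 1) * 2 ^ J * τ) / (1 - c)) +
        Bf * (8 * TJ / (1 - c)) := by rw [hηR]; field_simp; ring
    rw [e1]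
    have i1 : Bf * (2 * c ^ K) ≤ δ / 16 := by
      calc Bf * (2 * c ^ K) ≤ (Bf + 1) * (δ / (16 * (Bf + 1))) :=
            mul_le_mul (by linarith) hK (by positivity) (by linarith)
        _ = δ / 16 := by field_simp
    have i2 : Bf * (4 * (((J : ℝ) + 1) * 2 ^ J * τ) / (1 - c)) ≤ δ / 8 := by
      rw [mul_div_assoc', div_le_iff₀ h1c]
      calc Bf * (4 * (((J : ℝ) + 1) * 2 ^ J * τ)) ≤ (Bf + 1) * (4 * (δ * (1 - c) / (32 * (Bf + 1)))) :=
            mul_le_mul (by linarith) (by linarith [hτ2]) (by positivity) (by linarith)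
        _ = δ / 8 * (1 - c) := by field_simp; ring
    have i3 : Bf * (8 * TJ / (1 - c)) ≤ δ / 4 := by
      rw [mul_div_assoc', div_le_iff₀ h1c]
      calc Bf * (8 * TJ) ≤ (Bf + 1) * (8 * (δ * (1 - c) / (32 * (Bf + 1)))) :=
            mul_le_mul (by linarith) (by linarith [hTJ2]) (by positivity) (by linarith)
        _ = δ / 4 * (1 - c) := by field_simp; ring
    linarith
  have htot : 2 * (((J : ℝ) + 1) * 2 ^ J * τ + κp * ηR + 2 * TJ) + (Real.exp 1 / (1 - θ)) * ηR =
      2 * (((J : ℝ) + 1) * 2 ^ J * τ) + 4 * TJ + Bf * ηR := by rw [hBf]; ring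
  calc 2 * ((J + 1) * 2 ^ J * τ + (Real.exp 1 * (2 * Real.exp 1 * lam) / (1 - 2 * Real.exp 1 * lam) ^ 2) * ηR +
        2 * (Real.exp 1 * (2 * Real.exp 1 * lam) ^ (J + 1) / (1 - 2 * Real.exp 1 * lam))) +
        (Real.exp 1 / (1 - 2 * Real.exp 1 * lam)) * ηR
      = 2 * (((J : ℝ) + 1) * 2 ^ J * τ + κp * ηR + 2 * TJ) + (Real.exp 1 / (1 - θ)) * ηR := by
        simp only [hκp, hTJ, hθ]
    _ = 2 * (((J : ℝ) + 1) * 2 ^ J * τ) + 4 * TJ + Bf * ηR := htot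
    _ ≤ 2 * (δ / 16) + 4 * (δ / 16) + δ / 2 := by linarith [hτ1, hTJ1, hBfη]
    _ ≤ δ := by linarith

end Summit.AtomisticToContinuum.HydrodynamicLimit.Theorems.NearConstantShortTimeHL

end
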